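import Summits.ValiantsHypothesis.ValiantsHypothesis.Theorems.LacunarySymmetroidMatrixDescartesCensusFullAlternation

/-!
# `MatrixDescartes` census — DESCARTES' RULE ON A BOUNDED INTERVAL `(0, c)` (Möbius / Bernstein form)
# (`#{roots of f in (0,c)} ≤ Var(Ψ_c)`, `Ψ_c(y) = ∑ₖ fₖ cᵏ yᵏ (1+y)^{n−k} = (1+y)ⁿ f(cy/(1+y))`)

HONEST FRAMING.  Object-search cell `pub-symmetroid`, seat `val-sym-mdr-p1` (generation 18); helper file `--supports` the crux item
stmt-ValiantsHypothesis-18050 (`Theses.LacunarySymmetroid.MatrixDescartes`, OPEN, on HOLD) with NO closure claim.  A general INSTRUMENT: the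
classical interval form of Descartes' rule of signs (Jacobi / Vincent: substitute `x = cy/(1+y)`, which maps `y ∈ (0, ∞)` onto `x ∈ (0, c)`, and
count the sign variations of the resulting polynomial — the Bernstein coefficients of `f` on `[0, c]` up to binomial factors).  WHY HERE: with
`…PivotResolventRolle` (`Z₊(det F) ≤ 1 + #`critical points, all of them roots of the critical polynomial `Φ`), `…PivotRankOneResolventPairForm`
(`Φ = W² + S²P_e`, so `Φ > 0` where `P_e > 0`) and `…PivotRankOneResolventConfinement` (`P_e > 0` propagates to the right in chamber (C)), the
positive roots of the rank-one four-letter pencil in chamber (C) are bounded by `1 + #{roots of Φ in (0, c)}` for ANY `c` past the zero `x_P`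
of the e-signed pair form, hence by `1 + Var(Ψ_c)` (this file) — a kernel-checkable CERTIFICATE FORMAT.  Located (seat memo RESOLVENT-PROFILE.md
§3e, exact rational arithmetic, 240 chamber-(C) samples incl. clustered far-`t₀` designs): `Var(Ψ_c) ≤ 5` at `c = x_P(1 + 10⁻⁴)` throughout
(global `Var(Φ)` up to `21`), so the certificate would give `Z₊ ≤ 6` there; the UNIFORM bound `Var(Ψ_{x_P}) ≤ 7` (⟹ «(C) ≤ 8») is a conjecture,
not proved.  Nothing here bears on `MatrixDescartes` in its window, on `DoorA26` / `DoorA34`, registers / credences, or `VP ≠ VNP`.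

[folklore] Descartes' rule of signs (Mathlib `roots_countP_pos_le_signVariations`, tree `Census.card_posRoots_le_signVariations`), the Möbius
substitution.  No definitions, no named facts.
-/

-- `Summit.ValiantsHypothesis.ValiantsHypothesis.…` repeats a component by the D-0017 layout
-- (single-conjunct summit), which the `dupNamespace` linter flags; the name is mandated.
set_option linter.dupNamespace false

namespace Summit.ValiantsHypothesis.ValiantsHypothesis.Theorems.LacunarySymmetroidMatrixDescartes.Pivot.Resolvent

open Polynomial Finset Set
open scoped BigOperators

/-- Evaluation of the Möbius transform: for `y ≠ −1` and `natDegree f ≤ n`,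
`(∑_{k ≤ n} C(fₖ cᵏ) Xᵏ (1+X)^{n−k})(y) = (1+y)ⁿ · f(cy/(1+y))`. [folklore] -/
theorem eval_mobius (f : ℝ[X]) (c y : ℝ) (n : ℕ) (hn : f.natDegree ≤ n) (hy : 1 + y ≠ 0) :
    (∑ k ∈ Finset.range (n + 1), Polynomial.C (f.coeff k * c ^ k) * X ^ k * (1 + X) ^ (n - k)).eval y
      = (1 + y) ^ n * f.eval (c * y / (1 + y)) := by
  rw [eval_finsetSum, Polynomial.eval_eq_sum_range' (lt_of_le_of_lt hn (Nat.lt_succ_self n)), Finset.mul_sum]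
  refine Finset.sum_congr rfl fun k hk => ?_
  have hkn : k ≤ n := Nat.lt_succ_iff.1 (Finset.mem_range.1 hk)
  simp only [eval_mul, eval_C, eval_pow, eval_X, eval_add, eval_one]
  have hsplit : (1 + y) ^ n = (1 + y) ^ k * (1 + y) ^ (n - k) := by rw [← pow_add]; congr 1; omega
  rw [hsplit, div_pow, mul_pow]
  field_simp

/-- **DESCARTES ON `(0, c)` (Möbius form).**  For a real polynomial `f` with `natDegree f ≤ n` and `c > 0`, the number of distinct roots of
`f` in the open interval `(0, c)` is at most the number of sign variations of `Ψ_c := ∑_{k ≤ n} fₖ cᵏ Xᵏ (1+X)^{n−k}`.  (The substitution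
`x = cy/(1+y)` maps the positive roots of `Ψ_c` onto the roots of `f` in `(0, c)`.) [folklore: Jacobi–Vincent; tree `card_posRoots_le_signVariations`] -/
theorem card_roots_Ioo_le_signVariations_mobius (f : ℝ[X]) (c : ℝ) (hc : 0 < c) (n : ℕ) (hn : f.natDegree ≤ n) :
    (f.roots.toFinset.filter (fun x => 0 < x ∧ x < c)).card
      ≤ (∑ k ∈ Finset.range (n + 1), Polynomial.C (f.coeff k * c ^ k) * X ^ k * (1 + X) ^ (n - k)).signVariations := by
  classical
  set Ψ := ∑ k ∈ Finset.range (n + 1), Polynomial.C (f.coeff k * c ^ k) * X ^ k * (1 + X) ^ (n - k) with hΨ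
  by_cases hf : f = 0
  · simp [hf]
  -- `Ψ ≠ 0`: otherwise `f` would vanish on the whole interval `(0, c)`
  have hΨ0 : Ψ ≠ 0 := by
    intro h0
    apply hf
    apply Polynomial.eq_zero_of_infinite_isRoot
    have hsub : Set.Ioo (0 : ℝ) c ⊆ {x | f.IsRoot x} := by
      intro x hx
      have hcx : 0 < c - x := by linarith [hx.2]
      set y := x / (c - x) with hy
      have hy0 : 0 < y := div_pos hx.1 hcx
      have hy1 : 1 + y ≠ 0 := by linarith
      have hev := eval_mobius f c y n hn hy1
      rw [← hΨ, h0, eval_zero] at hev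
      have hc0 : c ≠ 0 := hc.ne'
      have hcx0 : c - x ≠ 0 := hcx.ne'
      have hxy : c * y / (1 + y) = x := by
        rw [div_eq_iff hy1, hy]
        field_simp
        ring
      rw [hxy] at hev
      have : f.eval x = 0 := by
        have h1 : (1 + y) ^ n ≠ 0 := pow_ne_zero _ hy1
        rcases mul_eq_zero.1 hev.symm with h | h
        · exact absurd h h1
        · exact h
      exact this
    exact Set.Infinite.mono hsub (Set.Ioo_infinite hc)
  -- the injection `x ↦ x/(c − x)` from roots of `f` in `(0,c)` into positive roots of `Ψ`
  have hmap : ∀ x ∈ f.roots.toFinset.filter (fun x => 0 < x ∧ x < c),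
      x / (c - x) ∈ Ψ.roots.toFinset.filter (fun y => 0 < y) := by
    intro x hx
    rw [Finset.mem_filter, Multiset.mem_toFinset, mem_roots hf] at hx
    obtain ⟨hroot, hx0, hxc⟩ := hx
    have hcx : 0 < c - x := by linarith
    have hy0 : 0 < x / (c - x) := div_pos hx0 hcx
    have hy1 : 1 + x / (c - x) ≠ 0 := by linarith
    rw [Finset.mem_filter, Multiset.mem_toFinset, mem_roots hΨ0, IsRoot.def, hΨ, eval_mobius f c _ n hn hy1]
    refine ⟨?_, hy0⟩
    have hc0 : c ≠ 0 := hc.ne'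
    have hcx0 : c - x ≠ 0 := hcx.ne'
    have hxy : c * (x / (c - x)) / (1 + x / (c - x)) = x := by
      rw [div_eq_iff hy1]
      field_simp
      ring
    rw [hxy, hroot.eq_zero, mul_zero]
  have hinj : Set.InjOn (fun x : ℝ => x / (c - x)) ↑(f.roots.toFinset.filter (fun x => 0 < x ∧ x < c)) := by
    intro x₁ hx₁ x₂ hx₂ h
    have h1 := (Finset.mem_filter.1 (Finset.mem_coe.1 hx₁)).2
    have h2 := (Finset.mem_filter.1 (Finset.mem_coe.1 hx₂)).2
    have hc1 : c - x₁ ≠ 0 := by linarith [h1.2]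
    have hc2 : c - x₂ ≠ 0 := by linarith [h2.2]
    simp only at h
    rw [div_eq_div_iff hc1 hc2] at h
    nlinarith [h1.1, h2.1]
  calc (f.roots.toFinset.filter (fun x => 0 < x ∧ x < c)).card
      ≤ (Ψ.roots.toFinset.filter (fun y => 0 < y)).card := Finset.card_le_card_of_injOn _ hmap hinj
    _ ≤ Ψ.signVariations := Census.card_posRoots_le_signVariations Ψ

/-- **Roots beyond a barrier.**  If a real polynomial `Φ` is positive on `[c, ∞)` (`c > 0`), all its positive roots lie in `(0, c)`, so their
number is at most `Var(Ψ_c)`.  (For the critical polynomial of the rank-one four-letter pencil in chamber (C): `Φ = W² + S²P_e > 0` past the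
zero of `P_e`.) [this file] -/
theorem card_posRoots_le_signVariations_mobius_of_pos (Φ : ℝ[X]) (c : ℝ) (hc : 0 < c) (n : ℕ) (hn : Φ.natDegree ≤ n)
    (hpos : ∀ x, c ≤ x → 0 < Φ.eval x) :
    (Φ.roots.toFinset.filter (fun x => 0 < x)).card
      ≤ (∑ k ∈ Finset.range (n + 1), Polynomial.C (Φ.coeff k * c ^ k) * X ^ k * (1 + X) ^ (n - k)).signVariations := by
  classical
  have hΦ0 : Φ ≠ 0 := by
    intro h; have := hpos c le_rfl; rw [h, eval_zero] at this; exact lt_irrefl _ this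
  have hsub : Φ.roots.toFinset.filter (fun x => 0 < x) = Φ.roots.toFinset.filter (fun x => 0 < x ∧ x < c) := by
    ext x
    simp only [Finset.mem_filter, Multiset.mem_toFinset, mem_roots hΦ0]
    constructor
    · rintro ⟨hr, hx⟩
      refine ⟨hr, hx, ?_⟩
      by_contra hxc
      push Not at hxc
      have := hpos x hxc
      rw [hr.eq_zero] at this
      exact lt_irrefl _ this
    · rintro ⟨hr, hx, -⟩; exact ⟨hr, hx⟩
  rw [hsub]
  exact card_roots_Ioo_le_signVariations_mobius Φ c hc n hn

end Summit.ValiantsHypothesis.ValiantsHypothesis.Theorems.LacunarySymmetroidMatrixDescartes.Pivot.Resolvent
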